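/-
Origin: expansion seat `prover-pub-hodgecm-mc-carch-1-g38-0`, handover #CA73 2026-08-21T03:41Z md5 6e2b8d392e71 (401 l.; NEW additive leaf; imports #CA71 Model.ArchKTypeOfCentralWeightPin34 + #CA72 Model.ArchKTypeOfCentralWeightR2 (this kit); ns HodgeCM.Model.ArchSideTerm + HodgeCM.Model.SInstance; 20 theorems 0 defs; NAMES for audit: HodgeCM.Model.SInstance.w_ROGT'C_mul_lineCharV_three_eq_torusScalar · HodgeCM.Model.SInstance.lineCharV_two_center_mul_lineC_ROGT'C · HodgeCM.Model.ArchSideTerm.lineCharV_three_etaT₃) (`HOME/mc/pub-hodgecm-mc-carch-1/stage71/HodgeCM/Model/ArchKTypeOfCentralWeightR234.lean`, md5 6e2b8d392e71, 401 lines);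
landed by the gen-30 packager (p-g30) in gate run 71 as `HodgeCM/Model/ArchKTypeOfCentralWeightR234.lean` (verbatim).
-/
/-
Copyright (c) 2026. Released under Apache 2.0 license as described in the file LICENSE.
Cell pub-hodgecm, MODEL layer (construction prover mc-carch-1, gen 38), row-9 (J-Liu-Θ) junction: (CF_k) ∕ (Hw_k′) ∕ (CC_k) INSTANTIATED AT
THE PIN OF RECORD R2 `SInstance.SROGT'C`, slots 2 and 3 (conjugated plane, second twist `ν'R`) — sibling of `Model/ArchKTypeOfCentralWeightR2`.
-/
import Summits.HodgeConjecture.HodgeCM.Model.ArchKTypeOfCentralWeightPin34_2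
import Summits.HodgeConjecture.HodgeCM.Model.ArchKTypeOfCentralWeightR2

/-!
# `w_k · s_k(centre) = torusScalar_k` AT THE PIN OF RECORD R2 (slots 2, 3)

The slot-2∕3 twin of `Model/ArchKTypeOfCentralWeightR2` (#CA72): #CA71 `Model/ArchKTypeOfCentralWeightPin34` proves (CF_k) ∕ (Hw_k′) ∕ (CC_k),
`k = 2, 3`, for the honest harmonic slot family of the CONJUGATED plane from binder-1's pin block `hemb eR eS hχ a hω hdef` (#CA66 currency, no
`h₁W`); this leaf plugs the pin of record `S := SInstance.SROGT'C @hGR @hGR₀ @hGR₁ @hGR₂ @hGR₃ @μ hΔ₁ hΔ₂ hΔ₃ V c` under the OG guard `hc : GOG V c`: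

* slot characters `η₂ ∕ η₃ := etaT₂ ∕ etaT₃ V c.D (EtaChi.η χVR (χWR μ) V c) (ν'R V c)` (`SROGT'C_eq_archSideOfT'`), archimedean inputs
  `A k := ART' … V c hc k` with `(ART' … k).Φinf = Φ_∞,k(⟨e₀, ·⟩)` at `eR ∕ eS := posIdxEquivUnit ∕ negIdxEquivEmpty (hpos_GOG V c hc).2.2…` BY
  `rfl` — § 1 `ART'_Φinf_two/three`, `SROGT'C_P_Φinf_eq_linePhi_two/three`;
* binder-1's pin block DISCHARGED by carch's #CA55 sockets `hχ := SInstance.hχ_two/three_R2_of_GOG … hc`, `hdef := SInstance.hdef_two/three_R2_of_GOG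
  … hc` (at `χW := χWR μ`; `ν'R V c = νOf ν₃R V c` by `rfl`), `a := defExponentTwo/Three …`, `hω := defExponentTwo/Three_spec …` (#CA49),
  `hemb := hc.1` — the terms glue-1's R2 E-children `…OGISTR2DJ…` plug into row 12 for lines 2, 3;
* whence, HYPOTHESIS-FREE UNDER THE GUARD (§§ 2, 3): **`lineCharV_two/three_smul_cmArchCenter_linePhi_ROGT'C`** ((CF_k) on the pinned vector),
  **`w_ART'_mul_lineCharV_two/three_eq_torusScalar`**, **`w_ROGT'C_mul_lineCharV_two/three_eq_torusScalar`** ((Hw_k′) with the pin's literal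
  weight — the `hw` input of the slot-2∕3 junction binders at `S := SROGT'C … V c`, `χ_k := etaT_k … (ν'R V c)`),
  **`archWeight_mul_lineCharV_two/three_eq_torusScalar_ROGT'C`** (weight read back as `archWeight L (μ c k)`), and
  **`lineCharV_two/three_center_mul_lineC_ROGT'C`** ((CC_k): `s_k(u_t · 1_V) · lineC_k(t) = 1`);
* § 0: `lineCharV_three … (etaT₃ V S η ν') = ν'` (the slot-3 dictionary twist IS `ν′`; #CA49 `cmConjLineChar₁_apply_mk_one`),
  `lineCharV_two … (etaT₂ V S η ν') v = ν'(v)⁻¹ · η(v,1) · χ′₀(v,1)`; slot 3 in `ν'R`-form: `w_ROGT'C_mul_ν'R_eq_torusScalar`, `ν'R_center_mul_lineC_ROGT'C`.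

Nothing is cited and nothing is minted: kernel lemmas over installed carch ∕ sinst-1 ∕ theta-3 modules; 0 records, 0 defs, 0 `def … : Prop`.
-/

set_option autoImplicit false

noncomputable section

open NumberField NumberField.InfinitePlace NumberField.mixedEmbedding IsDedekindDomain
open scoped Matrix TensorProduct Classical SchwartzMap
open MulAction
open Literature.Geometry.ComplexHyperbolic.BallModel (U21 x₀ stabilizerEquivK21 blockK blockU)
open Literature.NumberTheory.Automorphic.U21 (K21 matA sclD)
open Literature.AlgebraicGeometry.ShimuraVarieties Literature.AlgebraicGeometry.ShimuraVarieties.BallForms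
open Literature.NumberTheory.Automorphic Literature.NumberTheory.Automorphic.UnitaryGroup Literature.NumberTheory.Weil1964
open Literature.RepresentationTheory.KonnoKonno2007 Literature.RepresentationTheory.KonnoKonno2007.RealDualPair
open Literature.NumberTheory.GelbartRogawski1991 Literature.NumberTheory.GelbartRogawski1991.UnitaryDualPair
open Literature.Analysis.SegalBargmann
open HodgeCM.Adelic HodgeCM.PerL34 HodgeCM.Model.HypCensus HodgeCM.Model.SupplyInstance

/-! ### § 0. The `V`-characters of the second-twisted splits (generic `η`, `ν′`) -/

namespace HodgeCM.Model.ArchSideTerm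

section Split

variable {L : CMField} {ι₁ : L →+* ℂ} (V : HermSpace3 L ι₁) (S : StubTree.SeesawDatum L)
variable
  (hGR : (cmSplittingDatum (L : Type) finProdFinEquiv (frameD V) (frameD_real V) (frameD_ne V) (dW S) (dW_real S) (dW_ne S)).CompatibleSplitting)
  (hGR₂ : (cmSplittingDatum (L : Type) (e₁) (frameD V) (frameD_real V) (frameD_ne V) (lineVec (L : Type) (dW' S 0))
    (fun _ => dW'_real S 0) (fun _ => dW'_ne S 0)).CompatibleSplitting)
  (hGR₃ : (cmSplittingDatum (L : Type) (e₁) (frameD V) (frameD_real V) (frameD_ne V) (lineVec (L : Type) (dW' S 1))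
    (fun _ => dW'_real S 1) (fun _ => dW'_ne S 1)).CompatibleSplitting)
  (η : CMAdelic (L : Type) (frameD V) × CMAdelic (L : Type) (dW S) →* ℂˣ) (ν' : CMAdelic (L : Type) (frameD V) →* ℂˣ)

/-- `χ′₁(x, 1) = 1` for ANY see-saw datum `S` (#CA49 `cmConjLineChar₁_apply_mk_one` is the case `S := c.D`): K-1's conjugated line-1
see-saw character `cmConjLineChar₁ = char ∘ snd` has no `V`-part. -/
theorem cmConjLineChar₁_apply_mk_one_datum (x : CMAdelic (L : Type) (frameD V)) :
    cmConjLineChar₁ (L : Type) finProdFinEquiv e₁ (frameD V) (frameD_real V) (frameD_ne V) (dW S) (dW_real S) (dW_ne S) (dW' S)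
      (dW'_real S) (dW'_ne S) S.isoGL (isoGL_hg₀ S) hGR hGR₂ hGR₃ (x, 1) = 1 := by
  unfold cmConjLineChar₁
  simp

/-- **the slot-3 `V`-character of the `ν′`-twisted split IS `ν′`**: `lineCharV_three … (etaT₃ V S η ν') = ν'` (`etaT₃_apply_mk_one` and
`cmConjLineChar₁_apply_mk_one_datum` — the conjugated `χ′₁` has no `V`-part); at the pin of record `ν' := ν'R V c`. -/
theorem lineCharV_three_etaT₃ : lineCharV_three V S hGR hGR₂ hGR₃ (etaT₃ V S η ν') = ν' := by
  refine MonoidHom.ext fun v => ?_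
  rw [lineCharV_three_apply, etaT₃_apply_mk_one, cmConjLineChar₁_apply_mk_one_datum, mul_one]

/-- pointwise form of `lineCharV_three_etaT₃`. -/
theorem lineCharV_three_etaT₃_apply (v : CMAdelic (L : Type) (frameD V)) :
    lineCharV_three V S hGR hGR₂ hGR₃ (etaT₃ V S η ν') v = ν' v := by
  rw [lineCharV_three_etaT₃]

/-- the slot-2 `V`-character of the `ν′`-twisted split: `lineCharV_two … (etaT₂ V S η ν') v = ν'(v)⁻¹ · η(v, 1) · χ′₀(v, 1)` (`etaT₂_apply_mk_one`). -/
theorem lineCharV_two_etaT₂_apply (v : CMAdelic (L : Type) (frameD V)) :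
    lineCharV_two V S hGR hGR₂ hGR₃ (etaT₂ V S η ν') v =
      (ν' v)⁻¹ * η (v, 1) *
        cmConjLineChar₀ (L : Type) finProdFinEquiv e₁ (frameD V) (frameD_real V) (frameD_ne V) (dW S) (dW_real S) (dW_ne S)
          (dW' S) (dW'_real S) (dW'_ne S) S.isoGL (isoGL_hg₀ S) hGR hGR₂ hGR₃ (v, 1) := by
  rw [lineCharV_two_apply, etaT₂_apply_mk_one]

end Split

end HodgeCM.Model.ArchSideTerm

namespace HodgeCM.Model.SInstance

open HodgeCM.Model.ArchSideTerm

variable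
  (hGR : ∀ {L : CMField} {ι₁ : L →+* ℂ} (V : HermSpace3 L ι₁) (c : SeesawCtx L),
    (cmSplittingDatum (L : Type) finProdFinEquiv (frameD V) (frameD_real V) (frameD_ne V) (dW c.D) (dW_real c.D)
      (dW_ne c.D)).CompatibleSplitting)
  (hGR₀ : ∀ {L : CMField} {ι₁ : L →+* ℂ} (V : HermSpace3 L ι₁) (c : SeesawCtx L),
    (cmSplittingDatum (L : Type) (e₁) (frameD V) (frameD_real V) (frameD_ne V) (lineVec (L : Type) (dW c.D 0))
      (fun _ => dW_real c.D 0) (fun _ => dW_ne c.D 0)).CompatibleSplitting)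
  (hGR₁ : ∀ {L : CMField} {ι₁ : L →+* ℂ} (V : HermSpace3 L ι₁) (c : SeesawCtx L),
    (cmSplittingDatum (L : Type) (e₁) (frameD V) (frameD_real V) (frameD_ne V) (lineVec (L : Type) (dW c.D 1))
      (fun _ => dW_real c.D 1) (fun _ => dW_ne c.D 1)).CompatibleSplitting)
  (hGR₂ : ∀ {L : CMField} {ι₁ : L →+* ℂ} (V : HermSpace3 L ι₁) (c : SeesawCtx L),
    (cmSplittingDatum (L : Type) (e₁) (frameD V) (frameD_real V) (frameD_ne V) (lineVec (L : Type) (dW' c.D 0))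
      (fun _ => dW'_real c.D 0) (fun _ => dW'_ne c.D 0)).CompatibleSplitting)
  (hGR₃ : ∀ {L : CMField} {ι₁ : L →+* ℂ} (V : HermSpace3 L ι₁) (c : SeesawCtx L),
    (cmSplittingDatum (L : Type) (e₁) (frameD V) (frameD_real V) (frameD_ne V) (lineVec (L : Type) (dW' c.D 1))
      (fun _ => dW'_real c.D 1) (fun _ => dW'_ne c.D 1)).CompatibleSplitting)
  (μ : ∀ {L : CMField}, SeesawCtx L → Fin 4 → NumberField.InfinitePlace (L : Type) → ℤ)
  (hΔ₁ : ∀ {L : CMField} {ι₁ : L →+* ℂ} (V : HermSpace3 L ι₁) (c : SeesawCtx L), ∀ hc : GOG V c,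
    slotTypeVec V c (hGR V c) (hGR₀ V c) (hGR₁ V c) (hGR₂ V c) (hGR₃ V c) (hG_GOG V c hc) 1 -
      slotTypeVec V c (hGR V c) (hGR₀ V c) (hGR₁ V c) (hGR₂ V c) (hGR₃ V c) (hG_GOG V c hc) 0 = μ c 1 - μ c 0)
  (hΔ₂ : ∀ {L : CMField} {ι₁ : L →+* ℂ} (V : HermSpace3 L ι₁) (c : SeesawCtx L), ∀ hc : GOG V c,
    slotTypeVec V c (hGR V c) (hGR₀ V c) (hGR₁ V c) (hGR₂ V c) (hGR₃ V c) (hG_GOG V c hc) 2 -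
      slotTypeVec V c (hGR V c) (hGR₀ V c) (hGR₁ V c) (hGR₂ V c) (hGR₃ V c) (hG_GOG V c hc) 0 = μ c 2 - μ c 0)
  (hΔ₃ : ∀ {L : CMField} {ι₁ : L →+* ℂ} (V : HermSpace3 L ι₁) (c : SeesawCtx L), ∀ hc : GOG V c,
    slotTypeVec V c (hGR V c) (hGR₀ V c) (hGR₁ V c) (hGR₂ V c) (hGR₃ V c) (hG_GOG V c hc) 3 -
      slotTypeVec V c (hGR V c) (hGR₀ V c) (hGR₁ V c) (hGR₂ V c) (hGR₃ V c) (hG_GOG V c hc) 0 = μ c 3 - μ c 0)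

variable {L : CMField} {ι₁ : L →+* ℂ} (V : HermSpace3 L ι₁) (c : SeesawCtx L)

/-! ### § 2. Slot 2: the pinned vector (`rfl`), (CF₂), (Hw₂′), (CC₂) at the pin of record -/

/-- the archimedean test function of the pin's slot-2 input `ART' … 2` IS `Φ_∞,2(⟨e₀, ·⟩)` at `eR ∕ eS := posIdxEquivUnit ∕ negIdxEquivEmpty
(hpos_GOG V c hc).2.2.1` (`rfl`: `archLineInputT'_Φinf`, `archLineInputOf_Φinf`, `archLineDatumOfReadOff_Φinf`, theta-3's `linePhi_def`). -/
theorem ART'_Φinf_two (hc : GOG V c) :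
    (ART' @GOG @hG_GOG @hGR @(@χVR @hGR @hGR₀ @hGR₁) @(@νR @hGR₁) @(@ν'R @hGR₃) @hGR₀ @hGR₁ @hGR₂ @hGR₃ @μ @hpos_GOG @hΔ₁ @hΔ₂ @hΔ₃ V c hc
          2).Φinf =
      blockFamilyOfAt (L : Type) e₁ (frameD V) (frameD_real V) (frameD_ne V) (lineVec (L : Type) (dW' c.D 0)) (fun _ => dW'_real c.D 0)
        (fun _ => dW'_ne c.D 0) ι₁ (blockPosEquiv V) (blockNegEquiv V) (posIdxEquivUnit (hpos_GOG V c hc).2.2.1)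
        (negIdxEquivEmpty (hpos_GOG V c hc).2.2.1) (degOnePDual Empty) (binvPi 1) (dotProductEquiv ℂ (Fin 2) (Pi.single 0 1)) :=
  rfl

/-- under the OG guard the pinned archimedean vector of slot 2 of `SROGT'C` is theta-3's `linePhi V (dW' c.D 0) …`. -/
theorem SROGT'C_P_Φinf_eq_linePhi_two (hc : GOG V c) :
    ((SROGT'C @hGR @hGR₀ @hGR₁ @hGR₂ @hGR₃ @μ hΔ₁ hΔ₂ hΔ₃ V c).P 2).Φinf =
      linePhi V (dW' c.D 0) (dW'_real c.D 0) (dW'_ne c.D 0) (hpos_GOG V c hc).2.2.1 := by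
  rw [SROGT'C_P_Φinf @hGR @hGR₀ @hGR₁ @hGR₂ @hGR₃ @μ hΔ₁ hΔ₂ hΔ₃ V c hc 2]
  rfl

include hGR₀ hGR₁ μ in
/-- **(CF₂) AT THE PIN, hypothesis-free under the guard**: the archimedean centre `u_t · 1_V` in the `U(V)`-slot of the pin's twisted line-2
kernel FIXES the pinned vector: `lineCharV_2(u_t · 1_V) • ω_∞,2(t · 1₃, 1) (linePhi_2) = linePhi_2`. -/
theorem lineCharV_two_smul_cmArchCenter_linePhi_ROGT'C (hc : GOG V c)
    (t : ↥(Literature.NumberTheory.Automorphic.relNormOneInfUnits (↥(maximalRealSubfield L)) L)) :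
    ((lineCharV_two V c.D (hGR V c) (hGR₂ V c) (hGR₃ V c)
            (etaT₂ V c.D (EtaChi.η (@χVR @hGR @hGR₀ @hGR₁) (@χWR @hGR @hGR₀ @hGR₁ @μ) V c) (ν'R @hGR₃ V c))
          (CMCenter (L : Type) (frameD V) ((UnitaryGroup.cmAdelicOneEquivRelNormOne (L : Type)).symm
            (Literature.NumberTheory.Automorphic.relNormOneInfToIdeles (↥(maximalRealSubfield L)) L t))) : ℂˣ) : ℂ) •
        cmArchWeilRep (L : Type) e₁ (frameD V) (frameD_real V) (frameD_ne V) (lineVec (L : Type) (dW' c.D 0)) (fun _ => dW'_real c.D 0)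
          (fun _ => dW'_ne c.D 0) (hGR₂ V c) (cmArchCenter (L : Type) 3 (Matrix.diagonal (frameD V)) t, 1)
          (linePhi V (dW' c.D 0) (dW'_real c.D 0) (dW'_ne c.D 0) (hpos_GOG V c hc).2.2.1) =
      linePhi V (dW' c.D 0) (dW'_real c.D 0) (dW'_ne c.D 0) (hpos_GOG V c hc).2.2.1 :=
  lineCharV_two_smul_cmArchCenter_blockFamilyOfAt (V := V) (c := c) (hGR := hGR V c) (hGR₂ := hGR₂ V c) (hGR₃ := hGR₃ V c)
    (η₂ := (etaT₂ V c.D (EtaChi.η (@χVR @hGR @hGR₀ @hGR₁) (@χWR @hGR @hGR₀ @hGR₁ @μ) V c) (ν'R @hGR₃ V c)))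
    (hemb := hc.1) (eR := posIdxEquivUnit (hpos_GOG V c hc).2.2.1) (eS := negIdxEquivEmpty (hpos_GOG V c hc).2.2.1)
    (hχ := hχ_two_R2_of_GOG @hGR @hGR₀ @hGR₁ @hGR₂ @hGR₃ (@χWR @hGR @hGR₀ @hGR₁ @μ) V c hc)
    (a := defExponentTwo V c (hGR₂ V c) (hpos_GOG V c hc).2.2.1) (hω := defExponentTwo_spec V c (hGR₂ V c) (hpos_GOG V c hc).2.2.1)
    (hdef := hdef_two_R2_of_GOG @hGR @hGR₀ @hGR₁ @hGR₂ @hGR₃ (@χWR @hGR @hGR₀ @hGR₁ @μ) V c hc) (t := t)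
    (ℓ := dotProductEquiv ℂ (Fin 2) (Pi.single 0 1))

/-- **(Hw₂′) for the pin's slot-2 archimedean input `ART' … 2`, hypothesis-free under the guard**:
`(ART' … 2).w t · lineCharV_2(u_t · 1_V) = torusScalar_2(u_t)` (#CA71 `w_mul_lineCharV_two_eq_torusScalar_of_eq_blockFamilyOfAt` at the pin
sockets and `hΦ := ART'_Φinf_two`). -/
theorem w_ART'_mul_lineCharV_two_eq_torusScalar (hc : GOG V c)
    (t : ↥(Literature.NumberTheory.Automorphic.relNormOneInfUnits (↥(maximalRealSubfield L)) L)) :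
    (ART' @GOG @hG_GOG @hGR @(@χVR @hGR @hGR₀ @hGR₁) @(@νR @hGR₁) @(@ν'R @hGR₃) @hGR₀ @hGR₁ @hGR₂ @hGR₃ @μ @hpos_GOG @hΔ₁ @hΔ₂ @hΔ₃ V c hc
            2).w t *
        ((lineCharV_two V c.D (hGR V c) (hGR₂ V c) (hGR₃ V c)
            (etaT₂ V c.D (EtaChi.η (@χVR @hGR @hGR₀ @hGR₁) (@χWR @hGR @hGR₀ @hGR₁ @μ) V c) (ν'R @hGR₃ V c))
            (CMCenter (L : Type) (frameD V) ((UnitaryGroup.cmAdelicOneEquivRelNormOne (L : Type)).symm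
            (Literature.NumberTheory.Automorphic.relNormOneInfToIdeles (↥(maximalRealSubfield L)) L t))) : ℂˣ) : ℂ) =
      ((torusScalar_twoG V c.D (hGR V c) (hGR₂ V c) (hGR₃ V c)
          (etaT₂ V c.D (EtaChi.η (@χVR @hGR @hGR₀ @hGR₁) (@χWR @hGR @hGR₀ @hGR₁ @μ) V c) (ν'R @hGR₃ V c))
          ((UnitaryGroup.cmAdelicOneEquivRelNormOne (L : Type)).symm
            (Literature.NumberTheory.Automorphic.relNormOneInfToIdeles (↥(maximalRealSubfield L)) L t)) : ℂˣ) : ℂ) :=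
  w_mul_lineCharV_two_eq_torusScalar_of_eq_blockFamilyOfAt (V := V) (c := c) (hGR := hGR V c) (hGR₂ := hGR₂ V c) (hGR₃ := hGR₃ V c)
    (η₂ := (etaT₂ V c.D (EtaChi.η (@χVR @hGR @hGR₀ @hGR₁) (@χWR @hGR @hGR₀ @hGR₁ @μ) V c) (ν'R @hGR₃ V c)))
    (hemb := hc.1) (eR := posIdxEquivUnit (hpos_GOG V c hc).2.2.1) (eS := negIdxEquivEmpty (hpos_GOG V c hc).2.2.1)
    (hχ := hχ_two_R2_of_GOG @hGR @hGR₀ @hGR₁ @hGR₂ @hGR₃ (@χWR @hGR @hGR₀ @hGR₁ @μ) V c hc)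
    (a := defExponentTwo V c (hGR₂ V c) (hpos_GOG V c hc).2.2.1) (hω := defExponentTwo_spec V c (hGR₂ V c) (hpos_GOG V c hc).2.2.1)
    (hdef := hdef_two_R2_of_GOG @hGR @hGR₀ @hGR₁ @hGR₂ @hGR₃ (@χWR @hGR @hGR₀ @hGR₁ @μ) V c hc)
    (hGR₀ := hGR₀ V c) (hGR₁ := hGR₁ V c)
    (η₀ := etaT₀ V c.D (EtaChi.η (@χVR @hGR @hGR₀ @hGR₁) (@χWR @hGR @hGR₀ @hGR₁ @μ) V c) (νR @hGR₁ V c))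
    (η₁ := etaT₁ V c.D (EtaChi.η (@χVR @hGR @hGR₀ @hGR₁) (@χWR @hGR @hGR₀ @hGR₁ @μ) V c) (νR @hGR₁ V c))
    (η₃ := etaT₃ V c.D (EtaChi.η (@χVR @hGR @hGR₀ @hGR₁) (@χWR @hGR @hGR₀ @hGR₁ @μ) V c) (ν'R @hGR₃ V c))
    (A := ART' @GOG @hG_GOG @hGR @(@χVR @hGR @hGR₀ @hGR₁) @(@νR @hGR₁) @(@ν'R @hGR₃) @hGR₀ @hGR₁ @hGR₂ @hGR₃ @μ @hpos_GOG @hΔ₁ @hΔ₂ @hΔ₃ V c hc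
      2)
    (hΦ := ART'_Φinf_two @hGR @hGR₀ @hGR₁ @hGR₂ @hGR₃ @μ hΔ₁ hΔ₂ hΔ₃ V c hc) (t := t)

/-- **(Hw₂′) AT THE PIN OF RECORD, hypothesis-free under the guard** — the `hw` input of the slot-2 junction binder at
`S := SROGT'C … V c`, `χ_2 := etaT₂ V c.D (EtaChi.η χVR (χWR μ) V c) (ν'R V c)`:
`((SROGT'C … V c).P 2).w t · lineCharV_2(u_t · 1_V) = torusScalar_twoG … χ_2 (u_t)`. -/
theorem w_ROGT'C_mul_lineCharV_two_eq_torusScalar (hc : GOG V c)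
    (t : ↥(Literature.NumberTheory.Automorphic.relNormOneInfUnits (↥(maximalRealSubfield L)) L)) :
    ((SROGT'C @hGR @hGR₀ @hGR₁ @hGR₂ @hGR₃ @μ hΔ₁ hΔ₂ hΔ₃ V c).P 2).w t *
        ((lineCharV_two V c.D (hGR V c) (hGR₂ V c) (hGR₃ V c)
            (etaT₂ V c.D (EtaChi.η (@χVR @hGR @hGR₀ @hGR₁) (@χWR @hGR @hGR₀ @hGR₁ @μ) V c) (ν'R @hGR₃ V c))
            (CMCenter (L : Type) (frameD V) ((UnitaryGroup.cmAdelicOneEquivRelNormOne (L : Type)).symm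
            (Literature.NumberTheory.Automorphic.relNormOneInfToIdeles (↥(maximalRealSubfield L)) L t))) : ℂˣ) : ℂ) =
      ((torusScalar_twoG V c.D (hGR V c) (hGR₂ V c) (hGR₃ V c)
          (etaT₂ V c.D (EtaChi.η (@χVR @hGR @hGR₀ @hGR₁) (@χWR @hGR @hGR₀ @hGR₁ @μ) V c) (ν'R @hGR₃ V c))
          ((UnitaryGroup.cmAdelicOneEquivRelNormOne (L : Type)).symm
            (Literature.NumberTheory.Automorphic.relNormOneInfToIdeles (↥(maximalRealSubfield L)) L t)) : ℂˣ) : ℂ) := by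
  rw [SROGT'C_eq_archSideOfT' @hGR @hGR₀ @hGR₁ @hGR₂ @hGR₃ @μ hΔ₁ hΔ₂ hΔ₃ V c hc, archSideOfT'_P_w]
  exact w_ART'_mul_lineCharV_two_eq_torusScalar @hGR @hGR₀ @hGR₁ @hGR₂ @hGR₃ @μ hΔ₁ hΔ₂ hΔ₃ V c hc t

include hGR₀ hGR₁ hΔ₁ hΔ₂ hΔ₃ in
/-- **(Hw₂′) AT THE PIN OF RECORD with the weight read back**: `archWeight L (μ c 2) t · lineCharV_2(u_t · 1_V) = torusScalar_2(u_t)`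
(#CA60 `SROGT'C_P_w_apply`). -/
theorem archWeight_mul_lineCharV_two_eq_torusScalar_ROGT'C (hc : GOG V c)
    (t : ↥(Literature.NumberTheory.Automorphic.relNormOneInfUnits (↥(maximalRealSubfield L)) L)) :
    Literature.NumberTheory.Automorphic.archWeight (L : Type) (μ c 2) t *
        ((lineCharV_two V c.D (hGR V c) (hGR₂ V c) (hGR₃ V c)
            (etaT₂ V c.D (EtaChi.η (@χVR @hGR @hGR₀ @hGR₁) (@χWR @hGR @hGR₀ @hGR₁ @μ) V c) (ν'R @hGR₃ V c))
            (CMCenter (L : Type) (frameD V) ((UnitaryGroup.cmAdelicOneEquivRelNormOne (L : Type)).symm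
            (Literature.NumberTheory.Automorphic.relNormOneInfToIdeles (↥(maximalRealSubfield L)) L t))) : ℂˣ) : ℂ) =
      ((torusScalar_twoG V c.D (hGR V c) (hGR₂ V c) (hGR₃ V c)
          (etaT₂ V c.D (EtaChi.η (@χVR @hGR @hGR₀ @hGR₁) (@χWR @hGR @hGR₀ @hGR₁ @μ) V c) (ν'R @hGR₃ V c))
          ((UnitaryGroup.cmAdelicOneEquivRelNormOne (L : Type)).symm
            (Literature.NumberTheory.Automorphic.relNormOneInfToIdeles (↥(maximalRealSubfield L)) L t)) : ℂˣ) : ℂ) := by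
  rw [← SROGT'C_P_w_apply @hGR @hGR₀ @hGR₁ @hGR₂ @hGR₃ @μ hΔ₁ hΔ₂ hΔ₃ V c hc 2 t]
  exact w_ROGT'C_mul_lineCharV_two_eq_torusScalar @hGR @hGR₀ @hGR₁ @hGR₂ @hGR₃ @μ hΔ₁ hΔ₂ hΔ₃ V c hc t

include hGR₀ hGR₁ μ in
/-- **(CC₂) AT THE PIN OF RECORD, hypothesis-free under the guard**: `lineCharV_2(u_t · 1_V) · lineC_2(t) = 1` — on the archimedean
centre the `V`-twist of the pin's slot-2 dictionary record is the INVERSE of theta-3's centre eigenvalue `lineC V (dW' c.D 0) … (hGR₂ V c)` of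
the untwisted `ω_∞,2` on the pinned vector. -/
theorem lineCharV_two_center_mul_lineC_ROGT'C (hc : GOG V c)
    (t : ↥(Literature.NumberTheory.Automorphic.relNormOneInfUnits (↥(maximalRealSubfield L)) L)) :
    ((lineCharV_two V c.D (hGR V c) (hGR₂ V c) (hGR₃ V c)
            (etaT₂ V c.D (EtaChi.η (@χVR @hGR @hGR₀ @hGR₁) (@χWR @hGR @hGR₀ @hGR₁ @μ) V c) (ν'R @hGR₃ V c))
          (CMCenter (L : Type) (frameD V) ((UnitaryGroup.cmAdelicOneEquivRelNormOne (L : Type)).symm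
            (Literature.NumberTheory.Automorphic.relNormOneInfToIdeles (↥(maximalRealSubfield L)) L t))) : ℂˣ) : ℂ) *
        lineC V (dW' c.D 0) (dW'_real c.D 0) (dW'_ne c.D 0) (hGR₂ V c) t = 1 :=
  lineCharV_two_center_mul_lineC (V := V) (c := c) (hGR := hGR V c) (hGR₂ := hGR₂ V c) (hGR₃ := hGR₃ V c)
    (η₂ := (etaT₂ V c.D (EtaChi.η (@χVR @hGR @hGR₀ @hGR₁) (@χWR @hGR @hGR₀ @hGR₁ @μ) V c) (ν'R @hGR₃ V c)))
    (hemb := hc.1) (eR := posIdxEquivUnit (hpos_GOG V c hc).2.2.1) (eS := negIdxEquivEmpty (hpos_GOG V c hc).2.2.1)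
    (hχ := hχ_two_R2_of_GOG @hGR @hGR₀ @hGR₁ @hGR₂ @hGR₃ (@χWR @hGR @hGR₀ @hGR₁ @μ) V c hc)
    (a := defExponentTwo V c (hGR₂ V c) (hpos_GOG V c hc).2.2.1) (hω := defExponentTwo_spec V c (hGR₂ V c) (hpos_GOG V c hc).2.2.1)
    (hdef := hdef_two_R2_of_GOG @hGR @hGR₀ @hGR₁ @hGR₂ @hGR₃ (@χWR @hGR @hGR₀ @hGR₁ @μ) V c hc) (t := t)

/-! ### § 3. Slot 3: the pinned vector (`rfl`), (CF₃), (Hw₃′), (CC₃) at the pin of record -/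

/-- the archimedean test function of the pin's slot-3 input `ART' … 3` IS `Φ_∞,3(⟨e₀, ·⟩)` at `eR ∕ eS := posIdxEquivUnit ∕ negIdxEquivEmpty
(hpos_GOG V c hc).2.2.2` (`rfl`: `archLineInputT'_Φinf`, `archLineInputOf_Φinf`, `archLineDatumOfReadOff_Φinf`, theta-3's `linePhi_def`). -/
theorem ART'_Φinf_three (hc : GOG V c) :
    (ART' @GOG @hG_GOG @hGR @(@χVR @hGR @hGR₀ @hGR₁) @(@νR @hGR₁) @(@ν'R @hGR₃) @hGR₀ @hGR₁ @hGR₂ @hGR₃ @μ @hpos_GOG @hΔ₁ @hΔ₂ @hΔ₃ V c hc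
          3).Φinf =
      blockFamilyOfAt (L : Type) e₁ (frameD V) (frameD_real V) (frameD_ne V) (lineVec (L : Type) (dW' c.D 1)) (fun _ => dW'_real c.D 1)
        (fun _ => dW'_ne c.D 1) ι₁ (blockPosEquiv V) (blockNegEquiv V) (posIdxEquivUnit (hpos_GOG V c hc).2.2.2)
        (negIdxEquivEmpty (hpos_GOG V c hc).2.2.2) (degOnePDual Empty) (binvPi 1) (dotProductEquiv ℂ (Fin 2) (Pi.single 0 1)) :=
  rfl

/-- under the OG guard the pinned archimedean vector of slot 3 of `SROGT'C` is theta-3's `linePhi V (dW' c.D 1) …`. -/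
theorem SROGT'C_P_Φinf_eq_linePhi_three (hc : GOG V c) :
    ((SROGT'C @hGR @hGR₀ @hGR₁ @hGR₂ @hGR₃ @μ hΔ₁ hΔ₂ hΔ₃ V c).P 3).Φinf =
      linePhi V (dW' c.D 1) (dW'_real c.D 1) (dW'_ne c.D 1) (hpos_GOG V c hc).2.2.2 := by
  rw [SROGT'C_P_Φinf @hGR @hGR₀ @hGR₁ @hGR₂ @hGR₃ @μ hΔ₁ hΔ₂ hΔ₃ V c hc 3]
  rfl

include hGR₀ hGR₁ μ in
/-- **(CF₃) AT THE PIN, hypothesis-free under the guard**: the archimedean centre `u_t · 1_V` in the `U(V)`-slot of the pin's twisted line-3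
kernel FIXES the pinned vector: `lineCharV_3(u_t · 1_V) • ω_∞,3(t · 1₃, 1) (linePhi_3) = linePhi_3`. -/
theorem lineCharV_three_smul_cmArchCenter_linePhi_ROGT'C (hc : GOG V c)
    (t : ↥(Literature.NumberTheory.Automorphic.relNormOneInfUnits (↥(maximalRealSubfield L)) L)) :
    ((lineCharV_three V c.D (hGR V c) (hGR₂ V c) (hGR₃ V c)
            (etaT₃ V c.D (EtaChi.η (@χVR @hGR @hGR₀ @hGR₁) (@χWR @hGR @hGR₀ @hGR₁ @μ) V c) (ν'R @hGR₃ V c))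
          (CMCenter (L : Type) (frameD V) ((UnitaryGroup.cmAdelicOneEquivRelNormOne (L : Type)).symm
            (Literature.NumberTheory.Automorphic.relNormOneInfToIdeles (↥(maximalRealSubfield L)) L t))) : ℂˣ) : ℂ) •
        cmArchWeilRep (L : Type) e₁ (frameD V) (frameD_real V) (frameD_ne V) (lineVec (L : Type) (dW' c.D 1)) (fun _ => dW'_real c.D 1)
          (fun _ => dW'_ne c.D 1) (hGR₃ V c) (cmArchCenter (L : Type) 3 (Matrix.diagonal (frameD V)) t, 1)
          (linePhi V (dW' c.D 1) (dW'_real c.D 1) (dW'_ne c.D 1) (hpos_GOG V c hc).2.2.2) =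
      linePhi V (dW' c.D 1) (dW'_real c.D 1) (dW'_ne c.D 1) (hpos_GOG V c hc).2.2.2 :=
  lineCharV_three_smul_cmArchCenter_blockFamilyOfAt (V := V) (c := c) (hGR := hGR V c) (hGR₂ := hGR₂ V c) (hGR₃ := hGR₃ V c)
    (η₃ := (etaT₃ V c.D (EtaChi.η (@χVR @hGR @hGR₀ @hGR₁) (@χWR @hGR @hGR₀ @hGR₁ @μ) V c) (ν'R @hGR₃ V c)))
    (hemb := hc.1) (eR := posIdxEquivUnit (hpos_GOG V c hc).2.2.2) (eS := negIdxEquivEmpty (hpos_GOG V c hc).2.2.2)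
    (hχ := hχ_three_R2_of_GOG @hGR @hGR₀ @hGR₁ @hGR₂ @hGR₃ (@χWR @hGR @hGR₀ @hGR₁ @μ) V c hc)
    (a := defExponentThree V c (hGR₃ V c) (hpos_GOG V c hc).2.2.2) (hω := defExponentThree_spec V c (hGR₃ V c) (hpos_GOG V c hc).2.2.2)
    (hdef := hdef_three_R2_of_GOG @hGR @hGR₀ @hGR₁ @hGR₂ @hGR₃ (@χWR @hGR @hGR₀ @hGR₁ @μ) V c hc) (t := t)
    (ℓ := dotProductEquiv ℂ (Fin 2) (Pi.single 0 1))

/-- **(Hw₃′) for the pin's slot-3 archimedean input `ART' … 3`, hypothesis-free under the guard**: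
`(ART' … 3).w t · lineCharV_3(u_t · 1_V) = torusScalar_3(u_t)` (#CA71 `w_mul_lineCharV_three_eq_torusScalar_of_eq_blockFamilyOfAt` at the pin
sockets and `hΦ := ART'_Φinf_three`). -/
theorem w_ART'_mul_lineCharV_three_eq_torusScalar (hc : GOG V c)
    (t : ↥(Literature.NumberTheory.Automorphic.relNormOneInfUnits (↥(maximalRealSubfield L)) L)) :
    (ART' @GOG @hG_GOG @hGR @(@χVR @hGR @hGR₀ @hGR₁) @(@νR @hGR₁) @(@ν'R @hGR₃) @hGR₀ @hGR₁ @hGR₂ @hGR₃ @μ @hpos_GOG @hΔ₁ @hΔ₂ @hΔ₃ V c hc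
            3).w t *
        ((lineCharV_three V c.D (hGR V c) (hGR₂ V c) (hGR₃ V c)
            (etaT₃ V c.D (EtaChi.η (@χVR @hGR @hGR₀ @hGR₁) (@χWR @hGR @hGR₀ @hGR₁ @μ) V c) (ν'R @hGR₃ V c))
            (CMCenter (L : Type) (frameD V) ((UnitaryGroup.cmAdelicOneEquivRelNormOne (L : Type)).symm
            (Literature.NumberTheory.Automorphic.relNormOneInfToIdeles (↥(maximalRealSubfield L)) L t))) : ℂˣ) : ℂ) =
      ((torusScalar_threeG V c.D (hGR V c) (hGR₂ V c) (hGR₃ V c)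
          (etaT₃ V c.D (EtaChi.η (@χVR @hGR @hGR₀ @hGR₁) (@χWR @hGR @hGR₀ @hGR₁ @μ) V c) (ν'R @hGR₃ V c))
          ((UnitaryGroup.cmAdelicOneEquivRelNormOne (L : Type)).symm
            (Literature.NumberTheory.Automorphic.relNormOneInfToIdeles (↥(maximalRealSubfield L)) L t)) : ℂˣ) : ℂ) :=
  w_mul_lineCharV_three_eq_torusScalar_of_eq_blockFamilyOfAt (V := V) (c := c) (hGR := hGR V c) (hGR₂ := hGR₂ V c) (hGR₃ := hGR₃ V c)
    (η₃ := (etaT₃ V c.D (EtaChi.η (@χVR @hGR @hGR₀ @hGR₁) (@χWR @hGR @hGR₀ @hGR₁ @μ) V c) (ν'R @hGR₃ V c)))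
    (hemb := hc.1) (eR := posIdxEquivUnit (hpos_GOG V c hc).2.2.2) (eS := negIdxEquivEmpty (hpos_GOG V c hc).2.2.2)
    (hχ := hχ_three_R2_of_GOG @hGR @hGR₀ @hGR₁ @hGR₂ @hGR₃ (@χWR @hGR @hGR₀ @hGR₁ @μ) V c hc)
    (a := defExponentThree V c (hGR₃ V c) (hpos_GOG V c hc).2.2.2) (hω := defExponentThree_spec V c (hGR₃ V c) (hpos_GOG V c hc).2.2.2)
    (hdef := hdef_three_R2_of_GOG @hGR @hGR₀ @hGR₁ @hGR₂ @hGR₃ (@χWR @hGR @hGR₀ @hGR₁ @μ) V c hc)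
    (hGR₀ := hGR₀ V c) (hGR₁ := hGR₁ V c)
    (η₀ := etaT₀ V c.D (EtaChi.η (@χVR @hGR @hGR₀ @hGR₁) (@χWR @hGR @hGR₀ @hGR₁ @μ) V c) (νR @hGR₁ V c))
    (η₁ := etaT₁ V c.D (EtaChi.η (@χVR @hGR @hGR₀ @hGR₁) (@χWR @hGR @hGR₀ @hGR₁ @μ) V c) (νR @hGR₁ V c))
    (η₂ := etaT₂ V c.D (EtaChi.η (@χVR @hGR @hGR₀ @hGR₁) (@χWR @hGR @hGR₀ @hGR₁ @μ) V c) (ν'R @hGR₃ V c))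
    (A := ART' @GOG @hG_GOG @hGR @(@χVR @hGR @hGR₀ @hGR₁) @(@νR @hGR₁) @(@ν'R @hGR₃) @hGR₀ @hGR₁ @hGR₂ @hGR₃ @μ @hpos_GOG @hΔ₁ @hΔ₂ @hΔ₃ V c hc
      3)
    (hΦ := ART'_Φinf_three @hGR @hGR₀ @hGR₁ @hGR₂ @hGR₃ @μ hΔ₁ hΔ₂ hΔ₃ V c hc) (t := t)

/-- **(Hw₃′) AT THE PIN OF RECORD, hypothesis-free under the guard** — the `hw` input of the slot-3 junction binder at
`S := SROGT'C … V c`, `χ_3 := etaT₃ V c.D (EtaChi.η χVR (χWR μ) V c) (ν'R V c)`: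
`((SROGT'C … V c).P 3).w t · lineCharV_3(u_t · 1_V) = torusScalar_threeG … χ_3 (u_t)`. -/
theorem w_ROGT'C_mul_lineCharV_three_eq_torusScalar (hc : GOG V c)
    (t : ↥(Literature.NumberTheory.Automorphic.relNormOneInfUnits (↥(maximalRealSubfield L)) L)) :
    ((SROGT'C @hGR @hGR₀ @hGR₁ @hGR₂ @hGR₃ @μ hΔ₁ hΔ₂ hΔ₃ V c).P 3).w t *
        ((lineCharV_three V c.D (hGR V c) (hGR₂ V c) (hGR₃ V c)
            (etaT₃ V c.D (EtaChi.η (@χVR @hGR @hGR₀ @hGR₁) (@χWR @hGR @hGR₀ @hGR₁ @μ) V c) (ν'R @hGR₃ V c))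
            (CMCenter (L : Type) (frameD V) ((UnitaryGroup.cmAdelicOneEquivRelNormOne (L : Type)).symm
            (Literature.NumberTheory.Automorphic.relNormOneInfToIdeles (↥(maximalRealSubfield L)) L t))) : ℂˣ) : ℂ) =
      ((torusScalar_threeG V c.D (hGR V c) (hGR₂ V c) (hGR₃ V c)
          (etaT₃ V c.D (EtaChi.η (@χVR @hGR @hGR₀ @hGR₁) (@χWR @hGR @hGR₀ @hGR₁ @μ) V c) (ν'R @hGR₃ V c))
          ((UnitaryGroup.cmAdelicOneEquivRelNormOne (L : Type)).symm
            (Literature.NumberTheory.Automorphic.relNormOneInfToIdeles (↥(maximalRealSubfield L)) L t)) : ℂˣ) : ℂ) := by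
  rw [SROGT'C_eq_archSideOfT' @hGR @hGR₀ @hGR₁ @hGR₂ @hGR₃ @μ hΔ₁ hΔ₂ hΔ₃ V c hc, archSideOfT'_P_w]
  exact w_ART'_mul_lineCharV_three_eq_torusScalar @hGR @hGR₀ @hGR₁ @hGR₂ @hGR₃ @μ hΔ₁ hΔ₂ hΔ₃ V c hc t

include hGR₀ hGR₁ hΔ₁ hΔ₂ hΔ₃ in
/-- **(Hw₃′) AT THE PIN OF RECORD with the weight read back**: `archWeight L (μ c 3) t · lineCharV_3(u_t · 1_V) = torusScalar_3(u_t)`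
(#CA60 `SROGT'C_P_w_apply`). -/
theorem archWeight_mul_lineCharV_three_eq_torusScalar_ROGT'C (hc : GOG V c)
    (t : ↥(Literature.NumberTheory.Automorphic.relNormOneInfUnits (↥(maximalRealSubfield L)) L)) :
    Literature.NumberTheory.Automorphic.archWeight (L : Type) (μ c 3) t *
        ((lineCharV_three V c.D (hGR V c) (hGR₂ V c) (hGR₃ V c)
            (etaT₃ V c.D (EtaChi.η (@χVR @hGR @hGR₀ @hGR₁) (@χWR @hGR @hGR₀ @hGR₁ @μ) V c) (ν'R @hGR₃ V c))
            (CMCenter (L : Type) (frameD V) ((UnitaryGroup.cmAdelicOneEquivRelNormOne (L : Type)).symm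
            (Literature.NumberTheory.Automorphic.relNormOneInfToIdeles (↥(maximalRealSubfield L)) L t))) : ℂˣ) : ℂ) =
      ((torusScalar_threeG V c.D (hGR V c) (hGR₂ V c) (hGR₃ V c)
          (etaT₃ V c.D (EtaChi.η (@χVR @hGR @hGR₀ @hGR₁) (@χWR @hGR @hGR₀ @hGR₁ @μ) V c) (ν'R @hGR₃ V c))
          ((UnitaryGroup.cmAdelicOneEquivRelNormOne (L : Type)).symm
            (Literature.NumberTheory.Automorphic.relNormOneInfToIdeles (↥(maximalRealSubfield L)) L t)) : ℂˣ) : ℂ) := by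
  rw [← SROGT'C_P_w_apply @hGR @hGR₀ @hGR₁ @hGR₂ @hGR₃ @μ hΔ₁ hΔ₂ hΔ₃ V c hc 3 t]
  exact w_ROGT'C_mul_lineCharV_three_eq_torusScalar @hGR @hGR₀ @hGR₁ @hGR₂ @hGR₃ @μ hΔ₁ hΔ₂ hΔ₃ V c hc t

include hGR₀ hGR₁ μ in
/-- **(CC₃) AT THE PIN OF RECORD, hypothesis-free under the guard**: `lineCharV_3(u_t · 1_V) · lineC_3(t) = 1` — on the archimedean
centre the `V`-twist of the pin's slot-3 dictionary record is the INVERSE of theta-3's centre eigenvalue `lineC V (dW' c.D 1) … (hGR₃ V c)` of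
the untwisted `ω_∞,3` on the pinned vector. -/
theorem lineCharV_three_center_mul_lineC_ROGT'C (hc : GOG V c)
    (t : ↥(Literature.NumberTheory.Automorphic.relNormOneInfUnits (↥(maximalRealSubfield L)) L)) :
    ((lineCharV_three V c.D (hGR V c) (hGR₂ V c) (hGR₃ V c)
            (etaT₃ V c.D (EtaChi.η (@χVR @hGR @hGR₀ @hGR₁) (@χWR @hGR @hGR₀ @hGR₁ @μ) V c) (ν'R @hGR₃ V c))
          (CMCenter (L : Type) (frameD V) ((UnitaryGroup.cmAdelicOneEquivRelNormOne (L : Type)).symm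
            (Literature.NumberTheory.Automorphic.relNormOneInfToIdeles (↥(maximalRealSubfield L)) L t))) : ℂˣ) : ℂ) *
        lineC V (dW' c.D 1) (dW'_real c.D 1) (dW'_ne c.D 1) (hGR₃ V c) t = 1 :=
  lineCharV_three_center_mul_lineC (V := V) (c := c) (hGR := hGR V c) (hGR₂ := hGR₂ V c) (hGR₃ := hGR₃ V c)
    (η₃ := (etaT₃ V c.D (EtaChi.η (@χVR @hGR @hGR₀ @hGR₁) (@χWR @hGR @hGR₀ @hGR₁ @μ) V c) (ν'R @hGR₃ V c)))
    (hemb := hc.1) (eR := posIdxEquivUnit (hpos_GOG V c hc).2.2.2) (eS := negIdxEquivEmpty (hpos_GOG V c hc).2.2.2)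
    (hχ := hχ_three_R2_of_GOG @hGR @hGR₀ @hGR₁ @hGR₂ @hGR₃ (@χWR @hGR @hGR₀ @hGR₁ @μ) V c hc)
    (a := defExponentThree V c (hGR₃ V c) (hpos_GOG V c hc).2.2.2) (hω := defExponentThree_spec V c (hGR₃ V c) (hpos_GOG V c hc).2.2.2)
    (hdef := hdef_three_R2_of_GOG @hGR @hGR₀ @hGR₁ @hGR₂ @hGR₃ (@χWR @hGR @hGR₀ @hGR₁ @μ) V c hc) (t := t)

include hGR₀ hGR₁ μ in
/-- **(Hw₃′) AT THE PIN OF RECORD in `ν′`-form**: since `lineCharV_three … (etaT₃ …) = ν'R V c` (`lineCharV_three_etaT₃`), the slot-3 identity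
reads `((SROGT'C … V c).P 3).w t · ν'R(u_t · 1_V) = torusScalar_threeG … (etaT₃ …) (u_t)` — the slot-3 dictionary record is the `ν'R`-twisted one. -/
theorem w_ROGT'C_mul_ν'R_eq_torusScalar (hc : GOG V c)
    (t : ↥(Literature.NumberTheory.Automorphic.relNormOneInfUnits (↥(maximalRealSubfield L)) L)) :
    ((SROGT'C @hGR @hGR₀ @hGR₁ @hGR₂ @hGR₃ @μ hΔ₁ hΔ₂ hΔ₃ V c).P 3).w t *
        ((ν'R @hGR₃ V c
            (CMCenter (L : Type) (frameD V) ((UnitaryGroup.cmAdelicOneEquivRelNormOne (L : Type)).symm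
            (Literature.NumberTheory.Automorphic.relNormOneInfToIdeles (↥(maximalRealSubfield L)) L t))) : ℂˣ) : ℂ) =
      ((torusScalar_threeG V c.D (hGR V c) (hGR₂ V c) (hGR₃ V c)
          (etaT₃ V c.D (EtaChi.η (@χVR @hGR @hGR₀ @hGR₁) (@χWR @hGR @hGR₀ @hGR₁ @μ) V c) (ν'R @hGR₃ V c))
          ((UnitaryGroup.cmAdelicOneEquivRelNormOne (L : Type)).symm
            (Literature.NumberTheory.Automorphic.relNormOneInfToIdeles (↥(maximalRealSubfield L)) L t)) : ℂˣ) : ℂ) := by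
  rw [← lineCharV_three_etaT₃_apply V c.D (hGR V c) (hGR₂ V c) (hGR₃ V c)
    (EtaChi.η (@χVR @hGR @hGR₀ @hGR₁) (@χWR @hGR @hGR₀ @hGR₁ @μ) V c) (ν'R @hGR₃ V c)]
  exact w_ROGT'C_mul_lineCharV_three_eq_torusScalar @hGR @hGR₀ @hGR₁ @hGR₂ @hGR₃ @μ hΔ₁ hΔ₂ hΔ₃ V c hc t


-- port_pkg: scope closed for this part
end HodgeCM.Model.SInstance
end
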